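import Mathlib.Algebra.Order.Field.Basic
import Mathlib.Algebra.Order.AbsoluteValue.Basic
import Mathlib.Algebra.BigOperators.Group.List.Basic
import Mathlib.Tactic.Positivity
import Mathlib.Tactic.Ring
import Mathlib.Data.Nat.Prime.Defs
import HarnessLib

/-!
# Jeannerod–Rump: error of floating-point summation in any order (named facts)

HONEST FRAMING (venture CertifiedArithmetic / cell `pub-lowprec`): certified error envelopes and
provably optimal rounding/accumulation schemes for low-precision formats under stated cost models;
every table by two implementations; no hardware or vendor claims.

Typed VERBATIM as named facts (`def … : Prop`, not proved here) from C.-P. Jeannerod and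
S. M. Rump, *On relative errors of floating-point operations: optimal bounds and applications*,
Math. Comp. 87 (2018) 803–819 [JeannerodRump2018]: the setting of §1 — `F` = binary
floating-point numbers of precision `p` ("`M · 2^e`, `|M| < 2^p`"; we keep a lower exponent bound
`emin` so that gradual underflow is covered, as the paper notes for Theorem 4.1, and NO upper
bound: overflow is ignored as in the paper), `fl` = ANY round-to-nearest map into `F` (no tie rule
assumed), `u = 2^{-p}` — and
* Theorem 4.1 (`theorem41`): for `x₁ … xₙ ∈ F` and ANY evaluation order of `Σ xᵢ` (binary tree
  with `n - 1` floating-point additions), the local rounding errors satisfy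
  `Σ_{i<n} |eᵢ| ≤ σ_{n-1} Σᵢ |xᵢ|`, `σₖ := k u/(1+u)`, hence `|ŝ - s| ≤ (n-1)u/(1+u) · Σ|xᵢ|`;
* Theorem 3.2, radix-2 case (`theorem32_radix2`): the relative-error bound `u/(1+u)` for a
  floating-point PRODUCT is attained (optimal) iff `2^p + 1` is not prime.
Over `ℚ` (the cell's exact arithmetic; the paper works over `ℝ`, and every quantity involved is
rational). The venture's `roundNE` (a particular tie rule, bounded range) is an instance when no
overflow occurs; that bridge is the venture's business, not this file's.
-/

namespace Literature.ComputerArithmetic.JeannerodRump2018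

/-- `x` is a binary floating-point number of precision `p` with exponent at least `emin`:
`x = M · 2^e`, `|M| < 2^p`, `e ≥ emin` (no upper exponent bound: overflow ignored).
[cite: JeannerodRump2018, §1] -/
def IsFloat (p : ℕ) (emin : ℤ) (x : ℚ) : Prop :=
  ∃ M e : ℤ, |M| < 2 ^ p ∧ emin ≤ e ∧ x = (M : ℚ) * (2 : ℚ) ^ e

/-- The paper's `F` proper: precision `p`, UNBOUNDED exponent range (`x = M · 2^e`, `|M| < 2^p`,
`e ∈ ℤ`). [cite: JeannerodRump2018, §1] -/
def IsFloatU (p : ℕ) (x : ℚ) : Prop :=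
  ∃ M e : ℤ, |M| < 2 ^ p ∧ x = (M : ℚ) * (2 : ℚ) ^ e

/-- Round-to-nearest into the unbounded-exponent `F`. [cite: JeannerodRump2018, §1 eq. (1.1)] -/
def IsRoundNearestU (p : ℕ) (fl : ℚ → ℚ) : Prop :=
  ∀ t : ℚ, IsFloatU p (fl t) ∧ ∀ f : ℚ, IsFloatU p f → |t - fl t| ≤ |t - f|

/-- `fl` is a round-to-nearest map into `F`: `fl t ∈ F` and `|t - fl t| = min_{f ∈ F} |t - f|`
(any tie-breaking rule). [cite: JeannerodRump2018, §1 eq. (1.1)] -/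
def IsRoundNearest (p : ℕ) (emin : ℤ) (fl : ℚ → ℚ) : Prop :=
  ∀ t : ℚ, IsFloat p emin (fl t) ∧ ∀ f : ℚ, IsFloat p emin f → |t - fl t| ≤ |t - f|

/-- Unit roundoff `u = 2^{-p}` (radix 2). [cite: JeannerodRump2018, §1] -/
def unitRoundoff (p : ℕ) : ℚ := 1 / 2 ^ p

/-- An evaluation order of a sum: a binary tree whose leaves are the summands.
[cite: JeannerodRump2018, §4.1 (footnote 2)] -/
inductive SumTree
  | leaf : ℚ → SumTree
  | node : SumTree → SumTree → SumTree

namespace SumTree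

/-- The summands, left to right. [cite: JeannerodRump2018, §4.1] -/
def leaves : SumTree → List ℚ
  | leaf x => [x]
  | node l r => leaves l ++ leaves r

/-- The exact sum `s`. [cite: JeannerodRump2018, §4.1] -/
def exact : SumTree → ℚ
  | leaf x => x
  | node l r => exact l + exact r

/-- The floating-point evaluation `ŝ` in the given order with rounding `fl` (one rounding per
internal node). [cite: JeannerodRump2018, §4.1] -/
def eval (fl : ℚ → ℚ) : SumTree → ℚ
  | leaf x => x
  | node l r => fl (eval fl l + eval fl r)

/-- The local rounding errors `eᵢ` of the `n - 1` additions (one per internal node).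
[cite: JeannerodRump2018, §4.1] -/
def localErrors (fl : ℚ → ℚ) : SumTree → List ℚ
  | leaf _ => []
  | node l r => localErrors fl l ++ localErrors fl r ++
      [fl (eval fl l + eval fl r) - (eval fl l + eval fl r)]

end SumTree

/-- THEOREM 4.1 (any-order summation): for `x₁, …, xₙ ∈ F` and any evaluation order, the local
errors of the `n - 1` floating-point additions satisfy `Σ |eᵢ| ≤ σ_{n-1} · Σ |xᵢ|` with
`σₖ = k·u/(1+u)`; consequently `|ŝ - s| ≤ (n-1)·u/(1+u) · Σ|xᵢ|`. Holds without restriction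
on `n`, for any tie rule, and with gradual underflow. Named fact, not proved here.
[cite: JeannerodRump2018, Thm 4.1] -/
def theorem41 : Prop :=
  ∀ (p : ℕ) (emin : ℤ) (fl : ℚ → ℚ), 2 ≤ p → IsRoundNearest p emin fl →
    ∀ t : SumTree, (∀ x ∈ t.leaves, IsFloat p emin x) →
      ((t.localErrors fl).map abs).sum
        ≤ ((t.leaves.length - 1 : ℕ) : ℚ) * (unitRoundoff p / (1 + unitRoundoff p))
          * (t.leaves.map abs).sum

/-- Consequence recorded with Theorem 4.1: `|ŝ - s| ≤ Σ|eᵢ|` (telescoping), hence the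
`(n-1)u/(1+u)` bound on the total error. Named fact. [cite: JeannerodRump2018, eq. (1.3)] -/
def sumError_le : Prop :=
  ∀ (p : ℕ) (emin : ℤ) (fl : ℚ → ℚ), 2 ≤ p → IsRoundNearest p emin fl →
    ∀ t : SumTree, (∀ x ∈ t.leaves, IsFloat p emin x) →
      |t.eval fl - t.exact|
        ≤ ((t.leaves.length - 1 : ℕ) : ℚ) * (unitRoundoff p / (1 + unitRoundoff p))
          * (t.leaves.map abs).sum

/-- THEOREM 3.2, radix 2 (unbounded exponent range, as in the paper): the bound
`E₁(xy) ≤ u/(1+u)` for the product of two floating-point numbers is OPTIMAL (attained by some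
`x, y ∈ F` and some round-to-nearest `fl`) if and only if `2^p + 1` is not prime. Typed as the
attainment equivalence for `E₁`. Named fact. [cite: JeannerodRump2018, Thm 3.2] -/
def theorem32_radix2 : Prop :=
  ∀ p : ℕ, 2 ≤ p →
    ((∃ (fl : ℚ → ℚ) (x y : ℚ), IsRoundNearestU p fl ∧ IsFloatU p x ∧ IsFloatU p y ∧ x * y ≠ 0 ∧
        |x * y - fl (x * y)| = unitRoundoff p / (1 + unitRoundoff p) * |x * y|)
      ↔ ¬ Nat.Prime (2 ^ p + 1))

end Literature.ComputerArithmetic.JeannerodRump2018
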